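import Mathlib
import Literature.Analysis.ODE.RegularSingularAnalyticBranch
import HarnessLib

/-!
# The analytic branch at a regular singular point, II: the summed Frobenius series solves
# `x v′ = M(x) v + g(x)`, is analytic, and is the unique analytic solution through `v₀`

Topic `Literature/Analysis/ODE` (namespace `Literature.Analysis.ODE`). Continuation of
`RegularSingularAnalyticBranch.lean` (part I: the recursion `frobeniusCoeff`, its majorant `norm_frobeniusCoeff_le`,
and the calculus of `Σ xⁿ • wₙ`). Setting: `𝕜 = ℝ` or `ℂ` (`RCLike 𝕜`), `E` a Banach space, coefficient sequences
`M : ℕ → L(E)`, `g : ℕ → E`, inverses `Rₙ` of `n − M₀` (`n ≥ 1`), and a value `v₀` with `M₀ v₀ + g₀ = 0`.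

* THE TWO SIDES AS POWER SERIES (generic, `‖wₙ‖ ≤ B λⁿ`, `λ‖x‖ < 1`): `hasSum_pow_smul_natCast_smul`
  (`x • (Σ yⁿ • wₙ)′(x) = Σ xⁿ • (n wₙ)`) and `hasSum_pow_smul_sum_antidiagonal`
  (`(Σ xᵏ • Tₖ)(Σ xⁿ • wₙ) = Σ xⁿ • Σ_{k+l=n} T_k w_l`, the Cauchy product of part I);
* `frobeniusSol M g R v₀ x = Σ xⁿ • vₙ` — THE ANALYTIC BRANCH (`frobeniusSol_zero`: `v(0) = v₀`);
* `IsFrobeniusData M g R v₀ a K G c` — the quantitative hypotheses bundled (`‖Mₖ‖ ≤ K aᵏ`, `‖gₖ‖ ≤ G aᵏ` for `k ≥ 1`;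
  `Rₙ` a right inverse of `n − M₀` with `‖Rₙ‖ ≤ c/n`; `M₀ v₀ + g₀ = 0`); under them, with `λ := a (1 + 2cK)`:
  convergence (`hasSum_frobeniusSol`), term-wise derivative (`hasDerivAt_frobeniusSol`) and THE EQUATION
  (`frobeniusSol_ode`): `x • v′(x) = (Σ xᵏ • Mₖ)(v(x)) + Σ xᵏ • gₖ` on `λ‖x‖ < 1` (the coefficients of the two sides agree
  by `frobeniusCoeff_antidiagonal`);
* `IsFrobeniusData.analyticBranch` — THE QUANTITATIVE EXISTENCE THEOREM in one statement: `v(0) = v₀`,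
  `‖vₙ‖ ≤ max (‖v₀‖, 2cG) λⁿ`, convergence + differentiability + the equation + the sup bound
  `‖v(x)‖ ≤ max (‖v₀‖, 2cG)/(1 − λ‖x‖)` on `λ‖x‖ < 1`, and `HasFPowerSeriesOnBall v (coeffSeries v) 0 r` for every `r > 0`
  with `λ r ≤ 1` (so `v` is analytic at `0` in Mathlib's sense). All constants are explicit in `(a, K, G, c, ‖v₀‖)` —
  the parameter-uniform form needed when `M, g` depend analytically on a spectral parameter;
* UNIQUENESS: `natCast_smul_eq_of_ode` (a function `Σ xⁿ • wₙ` solving the equation on a ball has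
  `n wₙ = Σ_{k+l=n} M_k w_l + gₙ`: identity theorem for the two sides) and `IsFrobeniusData.eq_frobeniusCoeff_of_ode`
  (with `Rₙ` also a LEFT inverse — automatic in finite dimension — such a solution with `w₀ = v₀` IS the Frobenius
  series: the analytic branch through `v₀` is unique).

The classical statement for analytic `M(x)`, `g(x)` given as functions with power series at `0` is part III
(`RegularSingularAnalyticBranchClassical.lean`). NOT here (as in part I): the singular second branch, resonance,
uniqueness among `C¹`/`C^∞` solutions.

## References
* E. A. Coddington, N. Levinson, *Theory of Ordinary Differential Equations*, McGraw–Hill 1955, Ch. 4 (singularities of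
  the first kind). Key `CoddingtonLevinson1955`.
* P. Hartman, *Ordinary Differential Equations*, SIAM Classics 38 (2002), Ch. IV §§11–12. Key `Hartman2002`.
* W. Wasow, *Asymptotic Expansions for Ordinary Differential Equations*, Interscience 1965, Ch. II §5. Key `Wasow1965`.
-/

noncomputable section

open Finset Filter Metric
open scoped Topology NNReal ENNReal

namespace Literature.Analysis.ODE

variable {𝕜 : Type*} [RCLike 𝕜] {E : Type*} [NormedAddCommGroup E] [NormedSpace 𝕜 E]

/-! ### The two sides of the equation as power series -/

section TwoSides

variable {F : Type*} [NormedAddCommGroup F] [NormedSpace 𝕜 F] [CompleteSpace F]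

/-- LEFT-HAND SIDE: for `‖wₙ‖ ≤ B λⁿ` and `λ‖x‖ < 1`, `x • (Σ yⁿ • wₙ)′(x) = Σ xⁿ • (n • wₙ)`. [folklore] -/
theorem hasSum_pow_smul_natCast_smul {w : ℕ → F} {B lam : ℝ} (hw : ∀ n, ‖w n‖ ≤ B * lam ^ n) (hlam : 0 ≤ lam)
    {x : 𝕜} (hx : lam * ‖x‖ < 1) :
    HasSum (fun n : ℕ => x ^ n • ((n : 𝕜) • w n)) (x • deriv (fun y : 𝕜 => ∑' n, y ^ n • w n) x) := by
  obtain ⟨hDs, hderiv⟩ := hasDerivAt_tsum_pow_smul hw hlam hx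
  rw [hderiv.deriv]
  have heq : (fun n : ℕ => x ^ n • ((n : 𝕜) • w n)) = fun n : ℕ => x • (((n : 𝕜) * x ^ (n - 1)) • w n) := by
    funext n
    rw [smul_smul, smul_smul]
    rcases Nat.eq_zero_or_pos n with rfl | hn
    · simp
    · congr 1
      calc x ^ n * (n : 𝕜) = (n : 𝕜) * (x * x ^ (n - 1)) := by rw [mul_pow_sub_one hn.ne', mul_comm]
        _ = x * ((n : 𝕜) * x ^ (n - 1)) := by ring
  rw [heq]
  exact hDs.hasSum.const_smul x

/-- RIGHT-HAND SIDE (operator part): for `‖Tₖ‖ ≤ B_T λ_Tᵏ`, `‖wₙ‖ ≤ B λⁿ` and `λ_T‖x‖, λ‖x‖ < 1`,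
`(Σ xᵏ • Tₖ)(Σ xⁿ • wₙ) = Σ xⁿ • Σ_{k+l=n} T_k w_l` (Cauchy product). [folklore] -/
theorem hasSum_pow_smul_sum_antidiagonal {T : ℕ → F →L[𝕜] F} {w : ℕ → F} {BT lamT B lam : ℝ}
    (hT : ∀ n, ‖T n‖ ≤ BT * lamT ^ n) (hlamT : 0 ≤ lamT) (hw : ∀ n, ‖w n‖ ≤ B * lam ^ n) (hlam : 0 ≤ lam)
    {x : 𝕜} (hxT : lamT * ‖x‖ < 1) (hx : lam * ‖x‖ < 1) :
    HasSum (fun n => x ^ n • ∑ kl ∈ antidiagonal n, T kl.1 (w kl.2))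
      ((∑' k, x ^ k • T k) (∑' n, x ^ n • w n)) := by
  have hTn := summable_norm_pow_smul hT hlamT hxT
  have hwn := summable_norm_pow_smul hw hlam hx
  have hC := hasSum_sum_antidiagonal_apply hTn.of_norm.hasSum hwn.of_norm.hasSum hTn hwn
  convert hC using 1
  funext n
  rw [Finset.smul_sum]
  refine Finset.sum_congr rfl fun kl hkl => ?_
  rw [HasAntidiagonal.mem_antidiagonal] at hkl
  rw [smul_apply, ContinuousLinearMap.map_smul, smul_smul, ← pow_add, hkl]

end TwoSides

/-! ### The analytic branch -/

section Solution

/-- **The analytic branch** `v(x) = Σ xⁿ • vₙ` of `x v′ = M(x) v + g(x)` through `v(0) = v₀` (the sum of the Frobenius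
series; meaningful on its disc of convergence `λ‖x‖ < 1`). [cite: Hartman2002, Ch. IV §12 (12.12)] -/
def frobeniusSol (M : ℕ → E →L[𝕜] E) (g : ℕ → E) (R : ℕ → E →L[𝕜] E) (v₀ : E) (x : 𝕜) : E :=
  ∑' n, x ^ n • frobeniusCoeff M g R v₀ n

/-- `v(0) = v₀`. [folklore] -/
theorem frobeniusSol_zero (M : ℕ → E →L[𝕜] E) (g : ℕ → E) (R : ℕ → E →L[𝕜] E) (v₀ : E) :
    frobeniusSol M g R v₀ 0 = v₀ := by
  rw [frobeniusSol, tsum_pow_smul_zero, frobeniusCoeff_zero]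

/-- The hypotheses of the quantitative analytic-branch theorem, bundled: geometric bounds `‖Mₖ‖ ≤ K aᵏ`, `‖gₖ‖ ≤ G aᵏ`
(`k ≥ 1`), a right inverse `Rₙ` of `n − M₀` with `‖Rₙ‖ ≤ c/n` (`n ≥ 1`), and the order-`0` compatibility
`M₀ v₀ + g₀ = 0` (the shape in which a certified computation, or Cauchy estimates inside the radius of convergence,
deliver the hypotheses of the non-resonant Frobenius theorem). [folklore] -/
structure IsFrobeniusData (M : ℕ → E →L[𝕜] E) (g : ℕ → E) (R : ℕ → E →L[𝕜] E) (v₀ : E) (a K G c : ℝ) :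
    Prop where
  /-- `0 ≤ a` (`a = 1/ρ`, `ρ` a radius of geometric decay of the coefficients) -/
  a_nonneg : 0 ≤ a
  /-- `0 ≤ K` -/
  K_nonneg : 0 ≤ K
  /-- `0 ≤ G` -/
  G_nonneg : 0 ≤ G
  /-- `0 ≤ c` -/
  c_nonneg : 0 ≤ c
  /-- `‖Mₖ‖ ≤ K aᵏ` for `k ≥ 1` -/
  norm_M_le : ∀ k : ℕ, 1 ≤ k → ‖M k‖ ≤ K * a ^ k
  /-- `‖gₖ‖ ≤ G aᵏ` for `k ≥ 1` -/
  norm_g_le : ∀ k : ℕ, 1 ≤ k → ‖g k‖ ≤ G * a ^ k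
  /-- `Rₙ` is a right inverse of `n − M₀` for `n ≥ 1` -/
  rightInverse : ∀ n : ℕ, 1 ≤ n → ∀ w : E, (n : 𝕜) • R n w - M 0 (R n w) = w
  /-- `‖Rₙ‖ ≤ c/n` for `n ≥ 1` (non-resonance, quantified) -/
  norm_R_le : ∀ n : ℕ, 1 ≤ n → ‖R n‖ ≤ c / n
  /-- the order-`0` compatibility condition -/
  compat : M 0 v₀ + g 0 = 0

variable {M : ℕ → E →L[𝕜] E} {g : ℕ → E} {R : ℕ → E →L[𝕜] E} {v₀ : E} {a K G c : ℝ}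

/-- The majorant under `IsFrobeniusData`, with `B = max ‖v₀‖ (2cG)`. [folklore] -/
theorem IsFrobeniusData.norm_coeff_le (h : IsFrobeniusData M g R v₀ a K G c) (n : ℕ) :
    ‖frobeniusCoeff M g R v₀ n‖ ≤ max ‖v₀‖ (2 * c * G) * (a * (1 + 2 * c * K)) ^ n :=
  norm_frobeniusCoeff_le h.a_nonneg h.K_nonneg h.G_nonneg h.c_nonneg h.norm_M_le h.norm_g_le h.norm_R_le
    (le_max_left _ _) (le_max_right _ _) n

/-- All coefficients `Mₖ` (including `k = 0`) are bounded by `max ‖M₀‖ K · aᵏ`. [folklore] -/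
theorem IsFrobeniusData.norm_M_le' (h : IsFrobeniusData M g R v₀ a K G c) (k : ℕ) :
    ‖M k‖ ≤ max ‖M 0‖ K * a ^ k := by
  rcases Nat.eq_zero_or_pos k with rfl | hk
  · simp
  · exact (h.norm_M_le k hk).trans (mul_le_mul_of_nonneg_right (le_max_right _ _) (pow_nonneg h.a_nonneg k))

/-- All coefficients `gₖ` (including `k = 0`) are bounded by `max ‖g₀‖ G · aᵏ`. [folklore] -/
theorem IsFrobeniusData.norm_g_le' (h : IsFrobeniusData M g R v₀ a K G c) (k : ℕ) :
    ‖g k‖ ≤ max ‖g 0‖ G * a ^ k := by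
  rcases Nat.eq_zero_or_pos k with rfl | hk
  · simp
  · exact (h.norm_g_le k hk).trans (mul_le_mul_of_nonneg_right (le_max_right _ _) (pow_nonneg h.a_nonneg k))

/-- `0 ≤ λ = a(1 + 2cK)` and `a ≤ λ`. [folklore] -/
theorem IsFrobeniusData.a_le_lam (h : IsFrobeniusData M g R v₀ a K G c) :
    0 ≤ a * (1 + 2 * c * K) ∧ a ≤ a * (1 + 2 * c * K) := by
  have := h.a_nonneg; have := h.c_nonneg; have := h.K_nonneg
  exact ⟨by positivity, le_mul_of_one_le_right h.a_nonneg (by nlinarith)⟩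

/-- CONVERGENCE of the analytic branch on `λ ‖x‖ < 1`. [folklore] -/
theorem IsFrobeniusData.hasSum_frobeniusSol [CompleteSpace E] (h : IsFrobeniusData M g R v₀ a K G c) {x : 𝕜}
    (hx : a * (1 + 2 * c * K) * ‖x‖ < 1) :
    HasSum (fun n => x ^ n • frobeniusCoeff M g R v₀ n) (frobeniusSol M g R v₀ x) :=
  (summable_norm_pow_smul h.norm_coeff_le h.a_le_lam.1 hx).of_norm.hasSum

/-- DIFFERENTIABILITY of the analytic branch on `λ ‖x‖ < 1`, with the term-wise derivative. [folklore] -/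
theorem IsFrobeniusData.hasDerivAt_frobeniusSol [CompleteSpace E] (h : IsFrobeniusData M g R v₀ a K G c) {x : 𝕜}
    (hx : a * (1 + 2 * c * K) * ‖x‖ < 1) :
    HasDerivAt (frobeniusSol M g R v₀) (∑' n : ℕ, ((n : 𝕜) * x ^ (n - 1)) • frobeniusCoeff M g R v₀ n) x :=
  (hasDerivAt_tsum_pow_smul h.norm_coeff_le h.a_le_lam.1 hx).2

/-- **THE EQUATION.** On `λ ‖x‖ < 1` the analytic branch solves `x • v′(x) = M(x) v(x) + g(x)` with
`M(x) = Σ xᵏ • Mₖ`, `g(x) = Σ xᵏ • gₖ` (both absolutely convergent there, since `a ≤ λ`): the two sides are the power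
series `Σ xⁿ • (n vₙ)` and `Σ xⁿ • (Σ_{k+l=n} M_k v_l + gₙ)`, whose coefficients agree by `frobeniusCoeff_antidiagonal`.
[cite: CoddingtonLevinson1955, Ch. 4] -/
theorem IsFrobeniusData.frobeniusSol_ode [CompleteSpace E] (h : IsFrobeniusData M g R v₀ a K G c) {x : 𝕜}
    (hx : a * (1 + 2 * c * K) * ‖x‖ < 1) :
    x • deriv (frobeniusSol M g R v₀) x =
      (∑' k, x ^ k • M k) (frobeniusSol M g R v₀ x) + ∑' k, x ^ k • g k := by
  obtain ⟨hlam0, halam⟩ := h.a_le_lam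
  have hax : a * ‖x‖ < 1 := lt_of_le_of_lt (mul_le_mul_of_nonneg_right halam (norm_nonneg x)) hx
  have h1 := hasSum_pow_smul_natCast_smul h.norm_coeff_le hlam0 hx
  have h2 := (hasSum_pow_smul_sum_antidiagonal h.norm_M_le' h.a_nonneg h.norm_coeff_le hlam0 hax hx).add
    (summable_norm_pow_smul h.norm_g_le' h.a_nonneg hax).of_norm.hasSum
  have heq : (fun n : ℕ => x ^ n • ((n : 𝕜) • frobeniusCoeff M g R v₀ n)) = fun n : ℕ =>
      x ^ n • ∑ kl ∈ antidiagonal n, M kl.1 (frobeniusCoeff M g R v₀ kl.2) + x ^ n • g n := by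
    funext n
    rw [frobeniusCoeff_antidiagonal h.rightInverse h.compat n, smul_add]
  rw [heq] at h1
  exact h1.unique h2

/-- **THE ANALYTIC BRANCH AT A REGULAR SINGULAR POINT (non-resonant Frobenius theorem, exponent `0`, quantitative
form).** Under `IsFrobeniusData M g R v₀ a K G c` (`‖Mₖ‖ ≤ K aᵏ`, `‖gₖ‖ ≤ G aᵏ` for `k ≥ 1`; `Rₙ` a right inverse of
`n − M₀` with `‖Rₙ‖ ≤ c/n`; `M₀ v₀ + g₀ = 0`), with `λ := a (1 + 2cK)`: the Frobenius series `v(x) = Σ xⁿ • vₙ` has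
`v(0) = v₀`, coefficients `‖vₙ‖ ≤ max (‖v₀‖, 2cG) λⁿ`, converges and is differentiable on `λ‖x‖ < 1` where it solves
`x • v′(x) = M(x) v(x) + g(x)` and obeys `‖v(x)‖ ≤ max (‖v₀‖, 2cG)/(1 − λ‖x‖)`, and it is ANALYTIC: `coeffSeries v` is its
power series on every ball of radius `r > 0` with `λ r ≤ 1`. [cite: CoddingtonLevinson1955, Ch. 4] -/
theorem IsFrobeniusData.analyticBranch [CompleteSpace E] (h : IsFrobeniusData M g R v₀ a K G c) :
    frobeniusSol M g R v₀ 0 = v₀ ∧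
    (∀ n, ‖frobeniusCoeff M g R v₀ n‖ ≤ max ‖v₀‖ (2 * c * G) * (a * (1 + 2 * c * K)) ^ n) ∧
    (∀ x : 𝕜, a * (1 + 2 * c * K) * ‖x‖ < 1 →
      HasSum (fun n => x ^ n • frobeniusCoeff M g R v₀ n) (frobeniusSol M g R v₀ x) ∧
      DifferentiableAt 𝕜 (frobeniusSol M g R v₀) x ∧
      x • deriv (frobeniusSol M g R v₀) x =
        (∑' k, x ^ k • M k) (frobeniusSol M g R v₀ x) + ∑' k, x ^ k • g k ∧
      ‖frobeniusSol M g R v₀ x‖ ≤ max ‖v₀‖ (2 * c * G) / (1 - a * (1 + 2 * c * K) * ‖x‖)) ∧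
    (∀ r : ℝ≥0, 0 < r → a * (1 + 2 * c * K) * r ≤ 1 →
      HasFPowerSeriesOnBall (frobeniusSol M g R v₀) (coeffSeries (frobeniusCoeff M g R v₀)) 0 r) :=
  ⟨frobeniusSol_zero M g R v₀, h.norm_coeff_le,
    fun _ hx => ⟨h.hasSum_frobeniusSol hx, (h.hasDerivAt_frobeniusSol hx).differentiableAt, h.frobeniusSol_ode hx,
      norm_tsum_pow_smul_le h.norm_coeff_le h.a_le_lam.1 hx⟩,
    fun _ hr0 hr => hasFPowerSeriesOnBall_tsum_pow_smul h.norm_coeff_le h.a_le_lam.1 hr0 hr⟩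

end Solution

/-! ### Uniqueness among analytic solutions -/

section Uniqueness

variable {F : Type*} [NormedAddCommGroup F] [NormedSpace 𝕜 F]

/-- The `n`-th coefficient of `coeffSeries w` is `wₙ`. [folklore] -/
@[simp] theorem coeffSeries_coeff (w : ℕ → F) (n : ℕ) : (coeffSeries (𝕜 := 𝕜) w).coeff n = w n := by
  simp [FormalMultilinearSeries.coeff, coeffSeries, ContinuousMultilinearMap.mkPiRing_apply]

/-- `Σ_{k+l=n} T_k w_l = Σ_{k<n} T_{n−k} w_k + T₀ wₙ`. [folklore] -/
theorem sum_antidiagonal_apply_eq_sum_range (T : ℕ → F →L[𝕜] F) (w : ℕ → F) (n : ℕ) :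
    ∑ kl ∈ antidiagonal n, T kl.1 (w kl.2) = ∑ k ∈ range n, T (n - k) (w k) + T 0 (w n) := by
  rw [← Nat.sum_antidiagonal_swap]
  simp only [Prod.fst_swap, Prod.snd_swap]
  rw [Nat.sum_antidiagonal_eq_sum_range_succ (fun i j => T j (w i)), Finset.sum_range_succ, Nat.sub_self]

/-- `‖n • wₙ‖ ≤ B (2λ)ⁿ` when `‖wₙ‖ ≤ B λⁿ` (`n ≤ 2ⁿ`). [folklore] -/
theorem norm_natCast_smul_le_of_geometric {w : ℕ → F} {B lam : ℝ} (hw : ∀ n, ‖w n‖ ≤ B * lam ^ n) (n : ℕ) :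
    ‖(n : 𝕜) • w n‖ ≤ B * (2 * lam) ^ n := by
  have hB : 0 ≤ B := by simpa using (norm_nonneg _).trans (hw 0)
  have hn : (n : ℝ) ≤ 2 ^ n := by exact_mod_cast (Nat.lt_two_pow_self (n := n)).le
  rw [norm_smul, RCLike.norm_natCast, mul_pow]
  calc (n : ℝ) * ‖w n‖ ≤ 2 ^ n * (B * lam ^ n) := mul_le_mul hn (hw n) (norm_nonneg _) (by positivity)
    _ = B * (2 ^ n * lam ^ n) := by ring

/-- `‖Σ_{k+l=n} T_k w_l + gₙ‖ ≤ (K B + G)(2 max(a, λ))ⁿ` under geometric bounds on `T`, `w`, `g`. [folklore] -/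
theorem norm_sum_antidiagonal_apply_add_le {T : ℕ → F →L[𝕜] F} {w g : ℕ → F} {K a B lam G : ℝ}
    (hT : ∀ k, ‖T k‖ ≤ K * a ^ k) (hw : ∀ n, ‖w n‖ ≤ B * lam ^ n) (hg : ∀ k, ‖g k‖ ≤ G * a ^ k)
    (ha : 0 ≤ a) (hlam : 0 ≤ lam) (n : ℕ) :
    ‖∑ kl ∈ antidiagonal n, T kl.1 (w kl.2) + g n‖ ≤ (K * B + G) * (2 * max a lam) ^ n := by
  set m := max a lam with hm
  have hK : 0 ≤ K := by simpa using (norm_nonneg _).trans (hT 0)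
  have hB : 0 ≤ B := by simpa using (norm_nonneg _).trans (hw 0)
  have hG : 0 ≤ G := by simpa using (norm_nonneg _).trans (hg 0)
  have hm0 : 0 ≤ m := le_max_of_le_left ha
  have h1 : ‖∑ kl ∈ antidiagonal n, T kl.1 (w kl.2)‖ ≤ ((n : ℝ) + 1) * (K * B) * m ^ n := by
    calc ‖∑ kl ∈ antidiagonal n, T kl.1 (w kl.2)‖ ≤ ∑ kl ∈ antidiagonal n, ‖T kl.1 (w kl.2)‖ := norm_sum_le _ _
      _ ≤ ∑ kl ∈ antidiagonal n, K * B * m ^ n := by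
          refine Finset.sum_le_sum fun kl hkl => ?_
          rw [HasAntidiagonal.mem_antidiagonal] at hkl
          calc ‖T kl.1 (w kl.2)‖ ≤ ‖T kl.1‖ * ‖w kl.2‖ := (T kl.1).le_opNorm _
            _ ≤ (K * a ^ kl.1) * (B * lam ^ kl.2) := mul_le_mul (hT _) (hw _) (norm_nonneg _) (by positivity)
            _ ≤ (K * m ^ kl.1) * (B * m ^ kl.2) :=
                mul_le_mul (mul_le_mul_of_nonneg_left (pow_le_pow_left₀ ha (le_max_left _ _) _) hK)
                  (mul_le_mul_of_nonneg_left (pow_le_pow_left₀ hlam (le_max_right _ _) _) hB) (by positivity)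
                  (by positivity)
            _ = K * B * m ^ n := by rw [← hkl, pow_add]; ring
      _ = ((n : ℝ) + 1) * (K * B) * m ^ n := by
          rw [Finset.sum_const, Finset.Nat.card_antidiagonal, nsmul_eq_mul]
          push_cast
          ring
  have h2 : ‖g n‖ ≤ G * m ^ n :=
    (hg n).trans (mul_le_mul_of_nonneg_left (pow_le_pow_left₀ ha (le_max_left _ _) _) hG)
  have h3 : (n : ℝ) + 1 ≤ 2 ^ n := by exact_mod_cast Nat.succ_le_of_lt (Nat.lt_two_pow_self (n := n))
  have h4 : (1 : ℝ) ≤ 2 ^ n := one_le_pow₀ one_le_two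
  calc ‖∑ kl ∈ antidiagonal n, T kl.1 (w kl.2) + g n‖ ≤ ((n : ℝ) + 1) * (K * B) * m ^ n + G * m ^ n :=
        norm_add_le_of_le h1 h2
    _ ≤ 2 ^ n * (K * B) * m ^ n + 2 ^ n * (G * m ^ n) :=
        add_le_add (mul_le_mul_of_nonneg_right (mul_le_mul_of_nonneg_right h3 (by positivity)) (by positivity))
          (le_mul_of_one_le_left (by positivity) h4)
    _ = (K * B + G) * (2 * m) ^ n := by rw [mul_pow]; ring

/-- **COEFFICIENT IDENTITY FROM THE EQUATION.** If `u(x) = Σ xⁿ • wₙ` (geometrically bounded coefficients) solves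
`x • u′(x) = (Σ xᵏ • Tₖ)(u(x)) + Σ xᵏ • gₖ` on some ball `‖x‖ < δ`, then `n wₙ = Σ_{k+l=n} T_k w_l + gₙ` for every `n`
(identity theorem for the power series of the two sides). [folklore] -/
theorem natCast_smul_eq_of_ode [CompleteSpace F] {T : ℕ → F →L[𝕜] F} {w g : ℕ → F} {K a B lam G : ℝ}
    (hT : ∀ k, ‖T k‖ ≤ K * a ^ k) (hw : ∀ n, ‖w n‖ ≤ B * lam ^ n) (hg : ∀ k, ‖g k‖ ≤ G * a ^ k)
    (ha : 0 ≤ a) (hlam : 0 ≤ lam) {δ : ℝ} (hδ : 0 < δ)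
    (hode : ∀ x : 𝕜, ‖x‖ < δ → x • deriv (fun y : 𝕜 => ∑' n, y ^ n • w n) x =
      (∑' k, x ^ k • T k) (∑' n, x ^ n • w n) + ∑' k, x ^ k • g k) (n : ℕ) :
    (n : 𝕜) • w n = ∑ kl ∈ antidiagonal n, T kl.1 (w kl.2) + g n := by
  -- the two coefficient sequences and their geometric bounds
  set L : ℕ → F := fun n => (n : 𝕜) • w n with hL_def
  set Rt : ℕ → F := fun n => ∑ kl ∈ antidiagonal n, T kl.1 (w kl.2) + g n with hRt_def
  have hL : ∀ n, ‖L n‖ ≤ B * (2 * lam) ^ n := norm_natCast_smul_le_of_geometric hw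
  have hRt : ∀ n, ‖Rt n‖ ≤ (K * B + G) * (2 * max a lam) ^ n := norm_sum_antidiagonal_apply_add_le hT hw hg ha hlam
  -- a common radius `r > 0` with `r < δ`, `2λ r ≤ 1`, `2 max(a,λ) r ≤ 1`
  set ν : ℝ := 2 * max a lam + 2 * lam + δ⁻¹ + 1 with hν
  have hm0 : 0 ≤ max a lam := le_max_of_le_left ha
  have hδinv : 0 < δ⁻¹ := inv_pos.2 hδ
  have hν0 : 0 < ν := by positivity
  have hνδ : δ⁻¹ < ν := by rw [hν]; nlinarith
  set r : ℝ≥0 := Real.toNNReal ν⁻¹ with hr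
  have hrcoe : (r : ℝ) = ν⁻¹ := Real.coe_toNNReal _ (inv_pos.2 hν0).le
  have hr0 : 0 < r := Real.toNNReal_pos.2 (inv_pos.2 hν0)
  have hrδ : (r : ℝ) < δ := by
    rw [hrcoe]
    have := (inv_lt_inv₀ hν0 (inv_pos.2 hδ)).2 hνδ
    rwa [inv_inv] at this
  have hr1 : 2 * lam * r ≤ 1 := by
    rw [hrcoe, ← div_eq_mul_inv, div_le_one hν0, hν]; nlinarith
  have hr2 : 2 * max a lam * r ≤ 1 := by
    rw [hrcoe, ← div_eq_mul_inv, div_le_one hν0, hν]; nlinarith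
  have hPL := hasFPowerSeriesOnBall_tsum_pow_smul (𝕜 := 𝕜) hL (by positivity) hr0 hr1
  have hPR := hasFPowerSeriesOnBall_tsum_pow_smul (𝕜 := 𝕜) hRt (by positivity) hr0 hr2
  -- the two sums agree on the ball: they are the two sides of the equation
  have hagree : ∀ x : 𝕜, ‖x‖ < r → (∑' n, x ^ n • Rt n) = ∑' n, x ^ n • L n := by
    intro x hx
    have hx1 : 2 * lam * ‖x‖ < 1 := by nlinarith [norm_nonneg x]
    have hx2 : 2 * max a lam * ‖x‖ < 1 := by nlinarith [norm_nonneg x]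
    have hlamx : lam * ‖x‖ < 1 := by nlinarith [norm_nonneg x]
    have hax : a * ‖x‖ < 1 := by nlinarith [norm_nonneg x, le_max_left a lam]
    have h1 := hasSum_pow_smul_natCast_smul hw hlam hlamx
    have h2 := (hasSum_pow_smul_sum_antidiagonal hT ha hw hlam hax hlamx).add
      (summable_norm_pow_smul hg ha hax).of_norm.hasSum
    have h2' : HasSum (fun n => x ^ n • Rt n) ((∑' k, x ^ k • T k) (∑' n, x ^ n • w n) + ∑' k, x ^ k • g k) := by
      simpa only [hRt_def, smul_add] using h2
    rw [h2'.tsum_eq, h1.tsum_eq, hode x (hx.trans hrδ)]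
  -- hence the two power series coincide, coefficient by coefficient
  have heq : coeffSeries (𝕜 := 𝕜) Rt = coeffSeries L := by
    refine hPR.hasFPowerSeriesAt.eq_formalMultilinearSeries (hPL.hasFPowerSeriesAt.congr ?_)
    filter_upwards [Metric.ball_mem_nhds (0 : 𝕜) (show (0 : ℝ) < r from hr0)] with x hx
    rw [Metric.mem_ball, dist_zero_right] at hx
    exact (hagree x hx).symm
  have := congrArg (fun p : FormalMultilinearSeries 𝕜 𝕜 F => p.coeff n) heq
  simpa only [coeffSeries_coeff, hL_def, hRt_def] using this.symm

/-- **UNIQUENESS OF THE ANALYTIC BRANCH.** Under `IsFrobeniusData M g R v₀ a K G c` with `Rₙ` ALSO a left inverse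
of `n − M₀` (automatic in finite dimension): a function `u(x) = Σ xⁿ • wₙ` with geometrically bounded coefficients
and `w₀ = v₀` that solves `x • u′ = M(x) u + g(x)` on some ball `‖x‖ < δ` has `w = frobeniusCoeff M g R v₀` — so the
analytic solution through `v₀` is unique and equals `frobeniusSol M g R v₀` on the common disc.
[cite: CoddingtonLevinson1955, Ch. 4] -/
theorem IsFrobeniusData.eq_frobeniusCoeff_of_ode [CompleteSpace E] {M : ℕ → E →L[𝕜] E} {g : ℕ → E}
    {R : ℕ → E →L[𝕜] E} {v₀ : E} {a K G c : ℝ} (h : IsFrobeniusData M g R v₀ a K G c)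
    (hR' : ∀ n : ℕ, 1 ≤ n → ∀ w : E, R n ((n : 𝕜) • w - M 0 w) = w)
    {w : ℕ → E} {B lam : ℝ} (hw : ∀ n, ‖w n‖ ≤ B * lam ^ n) (hlam : 0 ≤ lam) (hw0 : w 0 = v₀)
    {δ : ℝ} (hδ : 0 < δ)
    (hode : ∀ x : 𝕜, ‖x‖ < δ → x • deriv (fun y : 𝕜 => ∑' n, y ^ n • w n) x =
      (∑' k, x ^ k • M k) (∑' n, x ^ n • w n) + ∑' k, x ^ k • g k) :
    w = frobeniusCoeff M g R v₀ := by
  refine frobeniusCoeff_unique hR' hw0 fun n hn => ?_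
  have hid := natCast_smul_eq_of_ode h.norm_M_le' hw h.norm_g_le' h.a_nonneg hlam hδ hode n
  rw [sum_antidiagonal_apply_eq_sum_range] at hid
  rw [hid]
  abel

end Uniqueness

end Literature.Analysis.ODE

end
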